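import Mathlib
import Summits.Langlands.Langlands.Theses.PhantomRMYoshida
import Summits.Langlands.Langlands.Theorems.PhantomRMYoshidaStableYoshidaCongruenceVacuousSectors
import Literature.NumberTheory.GaloisRepresentations.ModPGaloisRepCyclotomicProofs
import Literature.NumberTheory.GaloisRepresentations.LocalKroneckerWeberInertiaProofs
import Literature.NumberTheory.Automorphic.HilbertModularGaloisRepProofs
import HarnessLib

/-!
# Route `PhantomRMYoshida`, crux `StableYoshidaCongruence` (stmt-Langlands-13640): the crux HOLDS,
# vacuously, at twist pairs RAMIFIED at `p` (regime R1, `p` ramified in `E`)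

Helper file (`--supports stmt-Langlands-13640`, line lead c21, 2026-08-17; sequel of
`…VacuousSectors.lean`, p156419).  It does NOT close the crux; it proves the crux AT a class of data
and thereby kernel-checks the remaining vacuity entry of the standing disprover's regime table
(`Cruxes/StableYoshidaCongruence/Disproof.lean` §5 R1: "twist pairs `σ̄' ≅ σ̄ ⊗ η` … `p` split OR
RAMIFIED in `E` ⇒ no witness (vacuous)"; the split case is `cruxAt_of_twist_trivial_at_p`, p156419).

**Mechanism** (elementary; no lattice argument beyond the landed orientation lemma).  Let `v ∣ p`,
`I = I_{ℚ_v}`, `σ' = σ ⊗ η` entrywise.  Any `Sh`-witness makes the inertia invariants of `σ|_I` and of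
`σ'|_I` LINES (`finrank_invariants_inertia_eq_one`, p117060, packaged as
`cruxAt_of_finrank_invariants_inertia_ne_one`, p156419).  A non-zero `I`-invariant `a` of `σ` and a
non-zero `I`-invariant `b` of `η σ` give, for every `i ∈ I`, `det(σ(i) - 1) = 0` and
`det(η(i)σ(i) - 1) = 0`, i.e. `d - t + 1 = 0` and `η²d - ηt + 1 = 0` (`d = det σ(i)`, `t = tr σ(i)`),
whence the pointwise dichotomy `(η(i) d(i) - 1)(η(i) - 1) = 0` (`twist_eigen_dichotomy`).  Since `η`
and `d = det σ` are multiplicative on `I`, `I` would be the union of the two subgroups `ker η` and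
`ker (η · det σ)`, so one of them is all of `I`: either `η|_I = 1` or `η|_I = (det σ|_I)⁻¹ = ε̄|_I`
(`finrank_invariants_inertia_ne_one_of_twist`).  Hence:

* `cruxAt_of_twist_ramified_at_p` — if `η` is ramified at `v` (`η(i₀) ≠ 1` for some `i₀ ∈ I`) and
  `η|_I ≠ ε̄|_I` (`η(i₁) ≠ ε̄(i₁)` for some `i₁ ∈ I`), the witness hypothesis `∃ ρ, Sh ρ` is
  unsatisfiable and `CruxAt p k red σ σ'` HOLDS;
* `cruxAt_of_quadratic_twist_ramified_at_p` — for QUADRATIC `η` (`η² = 1`, e.g. `η = ω_E`) ramified at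
  `v` this is automatic as soon as `p ≠ 3`: `χ_p(I_{ℚ_v}) = ℤ_pˣ ∋ 2`
  (`adicCompletion_rat_exists_mem_absInertia_cyclotomicCharacter_eq`) gives `i ∈ I` with `ε̄(i) = 2`,
  and `η(i) = ε̄(i)` would force `4 = 1` in `k`, i.e. `p = 3`.

So for `p ≥ 5` the twist-pair regime R1 carries content ONLY at `p` inert in `E` (the TRUE-by-AI locus
of Disproof §5), and at `p = 3` only for ramified quadratic twists with `η|_{I_3} = ε̄` (= `ω_3` on
inertia).

**Cross-distinguishedness is necessary** (`cruxAt_of_common_local_eigencharacter`, a corollary of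
`cruxAt_of_local_charpoly_eq`, p156419): if `σ|_{Γ_{ℚ_v}}` and `σ'|_{Γ_{ℚ_v}}` have a COMMON
eigen-function `u` (non-zero `w, w'` with `σ(τ) w = u(τ) w`, `σ'(τ) w' = u(τ) w'` for all `τ ∈ Γ_{ℚ_v}`;
e.g. the unramified lines of `σ` and `σ'` at `p` carry the same character), then inside `CruxAt`
(`det σ' = det σ`) both characteristic polynomials on `Γ_{ℚ_v}` equal `(X - u)(X - det σ / u)`
(`FramedRep.charpoly_eq_of_eigenvector_two`), so no `Sh`-witness exists and the crux holds there.
Together with the orientation lemma (p117060) this kernel-checks the necessity half of Disproof §4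
"H5 ⟺ (σ̄, σ̄') is an ordinary `p`-distinguished Yoshida pair": a witness forces both members to be
ordinary-shaped at `p` AND the pair to be cross-distinguished at `p`.  [folklore]
-/

set_option linter.dupNamespace false -- `Summit.Langlands.Langlands` is the mandated namespace (D-0017)

noncomputable section

open Literature.NumberTheory.GaloisRepresentations
open Module IsDedekindDomain Matrix
open scoped NumberField
open Summit.Langlands.Langlands.Theses.PhantomRMYoshida
open Summit.Langlands.Langlands.Cruxes.StableYoshidaCongruence.LevelThreeWeierstrassSwitch
open Summit.Langlands.Langlands.Cruxes.StableYoshidaCongruence.BurkhardtWeddleTwoThreeAnchor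
  (det_val_eq_of_det_eq)

namespace Summit.Langlands.Langlands.Theorems.PhantomRMYoshida

section LinearAlgebra

variable {K : Type*} [Field K]

/-- **Eigen-dichotomy for a twist.**  If a `2 × 2` matrix `S` fixes a non-zero vector and `e • S`
fixes a non-zero vector, then `(e · det S - 1)(e - 1) = 0`: from `det(S - 1) = 0 = det(eS - 1)`,
i.e. `d - t + 1 = 0` and `e²d - et + 1 = 0`. [folklore] -/
theorem twist_eigen_dichotomy (S : Matrix (Fin 2) (Fin 2) K) (e : K) {a b : Fin 2 → K}
    (ha0 : a ≠ 0) (ha : S *ᵥ a = a) (hb0 : b ≠ 0) (hb : (e • S) *ᵥ b = b) :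
    (e * S.det - 1) * (e - 1) = 0 := by
  have h1 : (S - 1).det = 0 :=
    Matrix.exists_mulVec_eq_zero_iff.mp ⟨a, ha0, by rw [sub_mulVec, one_mulVec, ha, sub_self]⟩
  have h2 : (e • S - 1).det = 0 :=
    Matrix.exists_mulVec_eq_zero_iff.mp ⟨b, hb0, by rw [sub_mulVec, one_mulVec, hb, sub_self]⟩
  rw [Matrix.det_fin_two] at h1 h2
  simp only [Matrix.sub_apply, Matrix.smul_apply, smul_eq_mul, Matrix.one_apply_eq,
    Matrix.one_apply_ne (by decide : (0 : Fin 2) ≠ 1), Matrix.one_apply_ne (by decide : (1 : Fin 2) ≠ 0),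
    sub_zero] at h1 h2
  rw [Matrix.det_fin_two]
  linear_combination h2 - e * h1

end LinearAlgebra

section Main

variable {p : ℕ} [Fact p.Prime] {k : Type} [Field k] [CharP k p] [TopologicalSpace k]
  [DiscreteTopology k]

omit [DiscreteTopology k] in
/-- **Inertia invariants of a twist pair cannot both be lines** unless `η|_I = 1` or
`η|_I = (det σ|_I)⁻¹`.  `σ' = σ ⊗ η` entrywise; if some `i₀ ∈ I_{ℚ_v}` has `η(i₀) ≠ 1` and some
`i₁ ∈ I_{ℚ_v}` has `η(i₁) · det σ(i₁) ≠ 1`, then the inertia invariants of `σ` or of `σ'` at `v`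
(through `Γ_{ℚ_v} → Γ_ℚ`) do not form a line.  (A group is not the union of two proper subgroups,
applied to `ker η|_I` and `ker (η det σ)|_I` via `twist_eigen_dichotomy`.) [folklore] -/
theorem finrank_invariants_inertia_ne_one_of_twist (σ σ' : FramedGaloisRep ℚ k 2)
    (η : Field.absoluteGaloisGroup ℚ →* kˣ)
    (hη : ∀ x, ((σ' x : GL (Fin 2) k) : Matrix (Fin 2) (Fin 2) k) =
      ((η x : kˣ) : k) • ((σ x : GL (Fin 2) k) : Matrix (Fin 2) (Fin 2) k))
    (v : HeightOneSpectrum (𝓞 ℚ))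
    (h1 : ∃ i₀ ∈ absInertia (v.adicCompletion ℚ),
      η (absGaloisRestrict ℚ (v.adicCompletion ℚ) i₀) ≠ 1)
    (h2 : ∃ i₁ ∈ absInertia (v.adicCompletion ℚ),
      ((η (absGaloisRestrict ℚ (v.adicCompletion ℚ) i₁) : kˣ) : k) *
        ((σ (absGaloisRestrict ℚ (v.adicCompletion ℚ) i₁) : GL (Fin 2) k) :
          Matrix (Fin 2) (Fin 2) k).det ≠ 1) :
    Module.finrank k (Representation.invariants (σ.toRepresentation.comp
        ((absGaloisRestrict ℚ (v.adicCompletion ℚ)).toMonoidHom.comp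
          (absInertia (v.adicCompletion ℚ)).subtype))) ≠ 1 ∨
      Module.finrank k (Representation.invariants (σ'.toRepresentation.comp
        ((absGaloisRestrict ℚ (v.adicCompletion ℚ)).toMonoidHom.comp
          (absInertia (v.adicCompletion ℚ)).subtype))) ≠ 1 := by
  by_contra hcon
  obtain ⟨hA, hB⟩ := not_or.mp hcon
  rw [not_ne_iff] at hA hB
  set L := absGaloisRestrict ℚ (v.adicCompletion ℚ) with hL
  set A := Representation.invariants (σ.toRepresentation.comp
    (L.toMonoidHom.comp (absInertia (v.adicCompletion ℚ)).subtype)) with hAdef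
  set B := Representation.invariants (σ'.toRepresentation.comp
    (L.toMonoidHom.comp (absInertia (v.adicCompletion ℚ)).subtype)) with hBdef
  have hAbot : A ≠ ⊥ := fun h => by
    rw [h, finrank_bot] at hA
    exact zero_ne_one hA
  have hBbot : B ≠ ⊥ := fun h => by
    rw [h, finrank_bot] at hB
    exact zero_ne_one hB
  obtain ⟨a, haA, ha0⟩ := Submodule.exists_mem_ne_zero_of_ne_bot hAbot
  obtain ⟨b, hbB, hb0⟩ := Submodule.exists_mem_ne_zero_of_ne_bot hBbot
  -- the two invariance conditions, on matrices
  have ha : ∀ i ∈ absInertia (v.adicCompletion ℚ),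
      ((σ (L i) : GL (Fin 2) k) : Matrix (Fin 2) (Fin 2) k) *ᵥ a = a := fun i hi => by
    have h := (Representation.mem_invariants _ a).mp haA ⟨i, hi⟩
    simpa using h
  have hb : ∀ i ∈ absInertia (v.adicCompletion ℚ),
      (((η (L i) : kˣ) : k) • ((σ (L i) : GL (Fin 2) k) : Matrix (Fin 2) (Fin 2) k)) *ᵥ b = b :=
      fun i hi => by
    have h : ((σ' (L i) : GL (Fin 2) k) : Matrix (Fin 2) (Fin 2) k) *ᵥ b = b := by
      simpa using (Representation.mem_invariants _ b).mp hbB ⟨i, hi⟩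
    rwa [hη] at h
  -- scalar bookkeeping: `e i = η(i)`, `d i = det σ(i)` are multiplicative
  set e : Field.absoluteGaloisGroup (v.adicCompletion ℚ) → k := fun i => ((η (L i) : kˣ) : k)
    with he
  set d : Field.absoluteGaloisGroup (v.adicCompletion ℚ) → k := fun i =>
    ((σ (L i) : GL (Fin 2) k) : Matrix (Fin 2) (Fin 2) k).det with hd
  have he_mul : ∀ i j, e (i * j) = e i * e j := fun i j => by
    simp only [he, map_mul, Units.val_mul]
  have hd_mul : ∀ i j, d (i * j) = d i * d j := fun i j => by
    simp only [hd, map_mul, Matrix.GeneralLinearGroup.coe_mul, Matrix.det_mul]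
  -- the pointwise dichotomy on inertia
  have hdich : ∀ i ∈ absInertia (v.adicCompletion ℚ), (e i * d i - 1) * (e i - 1) = 0 :=
    fun i hi => twist_eigen_dichotomy _ (e i) ha0 (ha i hi) hb0 (hb i hi)
  obtain ⟨i₀, hi₀, hη₀⟩ := h1
  obtain ⟨i₁, hi₁, hη₁⟩ := h2
  have hη₀' : e i₀ ≠ 1 := fun h => hη₀ (Units.ext (by simpa [he] using h))
  have hη₁' : e i₁ * d i₁ ≠ 1 := hη₁
  -- `i₀ ∈ ker (η d)`, `i₁ ∈ ker η`
  have h0 : e i₀ * d i₀ = 1 := by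
    have h := hdich i₀ hi₀
    rcases mul_eq_zero.mp h with h' | h'
    · exact sub_eq_zero.mp h'
    · exact absurd (sub_eq_zero.mp h') hη₀'
  have h1' : e i₁ = 1 := by
    have h := hdich i₁ hi₁
    rcases mul_eq_zero.mp h with h' | h'
    · exact absurd (sub_eq_zero.mp h') hη₁'
    · exact sub_eq_zero.mp h'
  -- the product `i₀ i₁` lies in neither kernel
  have h01 := hdich (i₀ * i₁) (mul_mem hi₀ hi₁)
  rw [he_mul, hd_mul, h1', mul_one] at h01
  rcases mul_eq_zero.mp h01 with h' | h'
  · apply hη₁'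
    rw [h1', one_mul]
    have h'' : e i₀ * d i₀ * d i₁ = 1 := by linear_combination h'
    rwa [h0, one_mul] at h''
  · exact hη₀' (sub_eq_zero.mp h')

/-- **Twist pairs ramified at `p` with `η|_{I_p} ≠ ε̄|_{I_p}` (regime R1, `p` ramified in `E`).**
`p` odd; `σ' = σ ⊗ η` entrywise for a character `η : Γ_ℚ → kˣ`; `v ∣ p`; some inertia element
`i₀ ∈ I_{ℚ_v}` has `η(i₀) ≠ 1` and some `i₁ ∈ I_{ℚ_v}` has `η(i₁) ≠ ε̄(i₁)` (in `k`).  Then the crux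
holds at `(p, k, red, σ, σ')`, vacuously: under `det σ = ε̄⁻¹` (part of `CruxAt`'s `DetCond`) a
`Sh`-witness would make both inertia-invariant spaces lines
(`cruxAt_of_finrank_invariants_inertia_ne_one`), against
`finrank_invariants_inertia_ne_one_of_twist`. [folklore] -/
theorem cruxAt_of_twist_ramified_at_p (hp : p ≠ 2) {red : Valued.integer (PadicAlgCl p) →+* k}
    {σ σ' : FramedGaloisRep ℚ k 2} (η : Field.absoluteGaloisGroup ℚ →* kˣ)
    (hη : ∀ x, ((σ' x : GL (Fin 2) k) : Matrix (Fin 2) (Fin 2) k) =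
      ((η x : kˣ) : k) • ((σ x : GL (Fin 2) k) : Matrix (Fin 2) (Fin 2) k))
    (v : HeightOneSpectrum (𝓞 ℚ)) (hv : ((p : ℕ) : 𝓞 ℚ) ∈ v.asIdeal)
    (h1 : ∃ i₀ ∈ absInertia (v.adicCompletion ℚ),
      η (absGaloisRestrict ℚ (v.adicCompletion ℚ) i₀) ≠ 1)
    (h2 : ∃ i₁ ∈ absInertia (v.adicCompletion ℚ),
      ((η (absGaloisRestrict ℚ (v.adicCompletion ℚ) i₁) : kˣ) : k) ≠
        ZMod.castHom (dvd_refl p) k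
          ((epsBar p (absGaloisRestrict ℚ (v.adicCompletion ℚ) i₁) : (ZMod p)ˣ) : ZMod p)) :
    CruxAt p k red σ σ' := by
  intro hA hA' hirr hirr' hdet hnc hw hcpt ι
  refine cruxAt_of_finrank_invariants_inertia_ne_one hp v hv ?_ hA hA' hirr hirr' hdet hnc hw hcpt ι
  refine finrank_invariants_inertia_ne_one_of_twist σ σ' η hη v h1 ?_
  obtain ⟨i₁, hi₁, hne⟩ := h2
  refine ⟨i₁, hi₁, fun h => hne ?_⟩
  set g := absGaloisRestrict ℚ (v.adicCompletion ℚ) i₁ with hg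
  have hd := det_val_eq_of_det_eq ((hdet g).1)
  rw [hd, Units.val_inv_eq_inv_val, map_inv₀] at h
  have hne0 : ZMod.castHom (dvd_refl p) k ((epsBar p g : (ZMod p)ˣ) : ZMod p) ≠ 0 := by
    rw [map_ne_zero]
    exact Units.ne_zero _
  exact (mul_inv_eq_one₀ hne0).mp h

/-- **Quadratic twist pairs ramified at `p`, `p ≥ 5` (regime R1, `p` ramified in `E`).**  `p ≠ 2, 3`;
`σ' = σ ⊗ η` entrywise for a QUADRATIC character `η : Γ_ℚ → kˣ` (`η² = 1`, e.g. `η = ω_E`) that is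
ramified at `v ∣ p` (`η(i₀) ≠ 1` for some `i₀ ∈ I_{ℚ_v}`).  Then the crux holds at `(p, k, red, σ, σ')`,
vacuously.  The extra hypothesis of `cruxAt_of_twist_ramified_at_p` is automatic: `χ_p(I_{ℚ_v}) = ℤ_pˣ`
contains `2`, so some `i ∈ I_{ℚ_v}` has `ε̄(i) = 2`, and `η(i) = ε̄(i)` with `η(i)² = 1` would give
`4 = 1` in `k`, i.e. `p ∣ 3`.  (At `p = 3` the class `η|_{I_3} = ε̄ = ω_3` is genuinely exceptional.)
[folklore] -/
theorem cruxAt_of_quadratic_twist_ramified_at_p (hp : p ≠ 2) (hp3 : p ≠ 3)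
    {red : Valued.integer (PadicAlgCl p) →+* k} {σ σ' : FramedGaloisRep ℚ k 2}
    (η : Field.absoluteGaloisGroup ℚ →* kˣ) (hη2 : ∀ x, η x * η x = 1)
    (hη : ∀ x, ((σ' x : GL (Fin 2) k) : Matrix (Fin 2) (Fin 2) k) =
      ((η x : kˣ) : k) • ((σ x : GL (Fin 2) k) : Matrix (Fin 2) (Fin 2) k))
    (v : HeightOneSpectrum (𝓞 ℚ)) (hv : ((p : ℕ) : 𝓞 ℚ) ∈ v.asIdeal)
    (h1 : ∃ i₀ ∈ absInertia (v.adicCompletion ℚ),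
      η (absGaloisRestrict ℚ (v.adicCompletion ℚ) i₀) ≠ 1) :
    CruxAt p k red σ σ' := by
  refine cruxAt_of_twist_ramified_at_p hp η hη v hv h1 ?_
  by_contra hall
  have hall' : ∀ i ∈ absInertia (v.adicCompletion ℚ),
      ((η (absGaloisRestrict ℚ (v.adicCompletion ℚ) i) : kˣ) : k) =
        ZMod.castHom (dvd_refl p) k
          ((epsBar p (absGaloisRestrict ℚ (v.adicCompletion ℚ) i) : (ZMod p)ˣ) : ZMod p) :=
    fun i hi => by
      by_contra h
      exact hall ⟨i, hi, h⟩
  -- an inertia element with `χ_p = 2`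
  have h2unit : IsUnit ((2 : ℤ) : ℤ_[p]) := by
    rw [PadicInt.isUnit_iff]
    refine le_antisymm (PadicInt.norm_le_one _) (not_lt.mp fun hlt => ?_)
    have hdvd : (p : ℤ) ∣ 2 := (PadicInt.norm_int_lt_one_iff_dvd _).mp hlt
    have : p ∣ 2 := by exact_mod_cast hdvd
    exact hp ((Nat.prime_dvd_prime_iff_eq Fact.out Nat.prime_two).mp this)
  obtain ⟨τ, hτI, hτ⟩ :=
    adicCompletion_rat_exists_mem_absInertia_cyclotomicCharacter_eq p v
      (primesEquiv_eq_of_natCast_mem p v hv) h2unit.unit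
  -- `ε̄(τ) = 2`
  have hε : ((epsBar p (absGaloisRestrict ℚ (v.adicCompletion ℚ) τ) : (ZMod p)ˣ) : ZMod p) = 2 := by
    have h := toZMod_cyclotomicCharacter_apply ℚ p (absGaloisRestrict ℚ (v.adicCompletion ℚ) τ)
    rw [cyclotomicCharacter_absGaloisRestrict, hτ, IsUnit.unit_spec, map_intCast] at h
    change ((2 : ℤ) : ZMod p) =
      ((epsBar p (absGaloisRestrict ℚ (v.adicCompletion ℚ) τ) : (ZMod p)ˣ) : ZMod p) at h
    rw [← h, Int.cast_ofNat]
  -- `η(τ) = ε̄(τ) = 2` in `k`, and `η(τ)² = 1`, so `3 = 0` in `k`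
  have hηg : ((η (absGaloisRestrict ℚ (v.adicCompletion ℚ) τ) : kˣ) : k) = 2 := by
    rw [hall' τ hτI, hε, map_ofNat]
  have hsq : ((η (absGaloisRestrict ℚ (v.adicCompletion ℚ) τ) : kˣ) : k) *
      ((η (absGaloisRestrict ℚ (v.adicCompletion ℚ) τ) : kˣ) : k) = 1 := by
    rw [← Units.val_mul, hη2, Units.val_one]
  rw [hηg] at hsq
  have h3 : ((3 : ℕ) : k) = 0 := by
    rw [Nat.cast_ofNat]
    linear_combination hsq
  rw [CharP.cast_eq_zero_iff k p] at h3
  exact hp3 ((Nat.prime_dvd_prime_iff_eq Fact.out Nat.prime_three).mp h3)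

/-- **Pairs that are not cross-distinguished at `p` (vacuous).**  `p` odd, `v ∣ p`.  If the
restrictions of `σ` and `σ'` to `Γ_{ℚ_v}` (through `Γ_{ℚ_v} → Γ_ℚ`) admit non-zero vectors `w`, `w'`
and ONE function `u : Γ_{ℚ_v} → k` with `σ(τ) w = u(τ) w` and `σ'(τ) w' = u(τ) w'` for every `τ`
(e.g. the unramified inertia-invariant lines of `σ` and `σ'` at `p` carry the same character of
`Γ_{ℚ_v}`), then the crux holds at `(p, k, red, σ, σ')`: with `det σ' = det σ` (from `CruxAt`'s
`DetCond`) both local characteristic polynomials are `(X - u(τ))(X - det σ(τ)/u(τ))`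
(`FramedRep.charpoly_eq_of_eigenvector_two`), and `cruxAt_of_local_charpoly_eq` applies.  Contrapositive
content: an `Sh`-witness forces the pair to be CROSS-`p`-DISTINGUISHED. [folklore] -/
theorem cruxAt_of_common_local_eigencharacter (hp : p ≠ 2)
    {red : Valued.integer (PadicAlgCl p) →+* k} {σ σ' : FramedGaloisRep ℚ k 2}
    (v : HeightOneSpectrum (𝓞 ℚ)) (hv : ((p : ℕ) : 𝓞 ℚ) ∈ v.asIdeal)
    (u : Field.absoluteGaloisGroup (v.adicCompletion ℚ) → k) {w w' : Fin 2 → k}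
    (hw0 : w ≠ 0) (hw0' : w' ≠ 0)
    (hw : ∀ τ : Field.absoluteGaloisGroup (v.adicCompletion ℚ),
      ((σ (absGaloisRestrict ℚ (v.adicCompletion ℚ) τ) : GL (Fin 2) k) :
        Matrix (Fin 2) (Fin 2) k) *ᵥ w = u τ • w)
    (hw' : ∀ τ : Field.absoluteGaloisGroup (v.adicCompletion ℚ),
      ((σ' (absGaloisRestrict ℚ (v.adicCompletion ℚ) τ) : GL (Fin 2) k) :
        Matrix (Fin 2) (Fin 2) k) *ᵥ w' = u τ • w') :
    CruxAt p k red σ σ' := by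
  intro hA hA' hirr hirr' hdet hnc hwit hcpt ι
  refine cruxAt_of_local_charpoly_eq hp v hv (fun τ => ?_) hA hA' hirr hirr' hdet hnc hwit hcpt ι
  obtain ⟨-, h1⟩ := FramedRep.charpoly_eq_of_eigenvector_two σ hw0
    (g := absGaloisRestrict ℚ (v.adicCompletion ℚ) τ) (d := u τ) (by simpa using hw τ)
  obtain ⟨-, h2⟩ := FramedRep.charpoly_eq_of_eigenvector_two σ' hw0'
    (g := absGaloisRestrict ℚ (v.adicCompletion ℚ) τ) (d := u τ) (by simpa using hw' τ)
  have hdet' : Matrix.GeneralLinearGroup.det (σ' (absGaloisRestrict ℚ (v.adicCompletion ℚ) τ)) =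
      Matrix.GeneralLinearGroup.det (σ (absGaloisRestrict ℚ (v.adicCompletion ℚ) τ)) :=
    (hdet (absGaloisRestrict ℚ (v.adicCompletion ℚ) τ)).2
  rw [h1, h2, hdet']

end Main

end Summit.Langlands.Langlands.Theorems.PhantomRMYoshida

end
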